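import Summits.ResolutionOfSingularities.ResolutionOfSingularities.Theses.FrobeniusLadder
import Summits.ResolutionOfSingularities.ResolutionOfSingularities.Theorems.FrobeniusLadderRegularStalksClimb
import Literature.RingTheory.TightClosure.TightClosure
import Literature.RingTheory.TightClosure.RegularTightlyClosed

/-!
# `FRationalModification` — negative lemmas I: summit shadow and decoration

Support (negative) lemmas for crux `stmt-ResolutionOfSingularities-15316`
(`Summit.ResolutionOfSingularities.ResolutionOfSingularities.Theses.FrobeniusLadder.FRationalModification`,
route FrobeniusLadder, rank 3: a proper birational locally-integral CM F-injective model of a reduced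
separated finite-type `X/k`, `char k = p`, yields a proper birational F-rational model), filed by the
standing disprover (cdisprove gen 1, cycle 1; work file `Cruxes/FRationalModification/Disproof.lean`,
§1–§2). No definition is declared (the rung-2 / rung-3 stalk predicates of the route are written out
inline, verbatim) and no theorem asserts a Theses decl positively on its own. Companion file:
`Negative/RungTwoNotRungThree.lean` (the natural strengthening "the rung-2 model is already rung-3" is
false at every prime).

* `rungTwo_of_isRegularLocalRing`, `rungThree_of_isRegularLocalRing`: a regular local ring of prime
  characteristic satisfies BOTH stalk predicates (assembled from the tree's proof of the route's support
  item `RegularStalksClimb`, Matsumura 17.4 + Hochster–Huneke 4.4 via Kunz, and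
  `isFrobeniusClosed_of_isRegularLocalRing`); with `charP_stalk` a resolution of singularities is a
  model of every rung (`rungTwoModel_of_hasResolution`, `rungThreeModel_of_hasResolution`).
* `frobeniusLadder_iff_summit`: the route's conjunction of cruxes is EQUIVALENT to the summit
  (faithfulness; the deciding theorem `closes` is one direction); `not_summit_of_not_fRationalModification`:
  a refutation of the crux refutes the summit; `fRationalModification_without_antecedent_of_summit`: the
  summit gives an F-rational model outright, so the crux's antecedent is logically unnecessary (a line
  device) and cannot be shown load-bearing short of `¬summit`.
* `not_rungTwo_zero`: at exponent `p = 0` the Frobenius-closure clause degenerates (`y ^ 0 ^ 1 = 1`,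
  `(s)^[0^1] = ⊤`), so no nonempty Noetherian local ring is rung-2; hence
  `fRationalModification_at_zero` (the `p = 0` conjunct of the crux holds, vacuously off `X = ∅`) and
  `fRationalModification_without_prime_iff`: `p.Prime` is decoration.

## Sources
* H. Matsumura, *Commutative Ring Theory*, Thm. 17.4 (iii), 17.8, 14.3 (in tree).
* M. Hochster, C. Huneke, J. Amer. Math. Soc. 3 (1990), Thm. 4.4; C. Huneke, I. Swanson, *Integral
  closure of ideals, rings, and modules*, Thm. 13.1.2 (6) (in tree: `isFRational_of_isRegularLocalRing`).
* R. Fedder, K.-i. Watanabe, MSRI Publ. 15 (1989), Def. 1.10 (F-rational; tree vocabulary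
  `Literature/RingTheory/TightClosure`).
-/

noncomputable section

open CategoryTheory AlgebraicGeometry IsLocalRing
open Literature.AlgebraicGeometry.Resolution Literature.RingTheory.TightClosure
open Summit.ResolutionOfSingularities.ResolutionOfSingularities.Theses.FrobeniusLadder

-- single-problem summit: the doubled namespace component `ResolutionOfSingularities` is forced
set_option linter.dupNamespace false

namespace Summit.ResolutionOfSingularities.ResolutionOfSingularities.Theorems.FRationalModification.Negative

/-! ## §1 Summit shadow -/

/-- Every stalk of a `k`-scheme has the characteristic of `k` (it receives the field `k`).
[folklore] -/
theorem charP_stalk {p : ℕ} {k : Type} [Field k] [CharP k p] {Y : Scheme.{0}}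
    (g : Y ⟶ Spec (.of k)) (y : Y) : CharP (Y.presheaf.stalk y) p := by
  let φ : k →+* Y.presheaf.stalk y :=
    (Y.presheaf.germ ⊤ y trivial).hom.comp (g.appTop.hom.comp (Scheme.ΓSpecIso (.of k)).inv.hom)
  exact charP_of_injective_ringHom φ.injective p

/-- **A regular local ring of prime characteristic `p` satisfies the route's rung-3 stalk predicate**
(domain; every s.o.p. ideal tightly closed, inline form) — the tree's `RegularStalksClimb_proof`
(Hochster–Huneke: every ideal of a regular local ring is tightly closed). [cite: HunekeSwanson2006,
Thm. 13.1.2 (6)] -/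
theorem rungThree_of_isRegularLocalRing {p : ℕ} (hp : p.Prime) (R : Type) [CommRing R] [CharP R p]
    (hR : IsRegularLocalRing R) :
    (IsDomain R ∧ ∀ d : ℕ, ringKrullDim R = d → ∀ s : Fin d → R,
        (Ideal.span (Set.range s)).radical.IsMaximal → ∀ y c : R, c ≠ 0 →
          (∀ e : ℕ, c * y ^ p ^ e ∈ Ideal.span ((fun z : R => z ^ p ^ e) ''
            (Ideal.span (Set.range s) : Set R))) → y ∈ Ideal.span (Set.range s)) := by
  haveI := hR
  haveI : IsDomain R := isDomain_of_isRegularLocalRing R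
  exact ⟨inferInstance, fun d hd s hs => (Theorems.RegularStalksClimb_proof p hp R hR d hd s hs).2⟩

/-- **A regular local ring of prime characteristic `p` satisfies the route's rung-2 stalk predicate**
(domain; every s.o.p. is a weakly regular sequence generating a Frobenius-closed ideal).
[cite: Matsumura1987, Thm. 17.4 (iii); HunekeSwanson2006, Thm. 13.1.2 (6)] -/
theorem rungTwo_of_isRegularLocalRing {p : ℕ} (hp : p.Prime) (R : Type) [CommRing R] [CharP R p]
    (hR : IsRegularLocalRing R) :
    (IsDomain R ∧ ∀ d : ℕ, ringKrullDim R = d → ∀ s : Fin d → R,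
        (Ideal.span (Set.range s)).radical.IsMaximal →
          RingTheory.Sequence.IsWeaklyRegular R (List.ofFn s) ∧
            ∀ y : R, (∃ e : ℕ, y ^ p ^ e ∈ Ideal.span ((fun z : R => z ^ p ^ e) ''
              (Ideal.span (Set.range s) : Set R))) → y ∈ Ideal.span (Set.range s)) := by
  haveI := hR
  haveI : Fact p.Prime := ⟨hp⟩
  haveI : IsDomain R := isDomain_of_isRegularLocalRing R
  refine ⟨inferInstance, fun d hd s hs =>
    ⟨(Theorems.RegularStalksClimb_proof p hp R hR d hd s hs).1, ?_⟩⟩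
  exact (isFrobeniusClosed_iff p).mp (isFrobeniusClosed_of_isRegularLocalRing p _)

/-- **A resolution of singularities is a rung-3 (F-rational) model** (`char k = p` prime). [folklore] -/
theorem rungThreeModel_of_hasResolution {p : ℕ} (hp : p.Prime) {k : Type} [Field k] [CharP k p]
    {X : Scheme.{0}} (f : X ⟶ Spec (.of k)) (h : Scheme.HasResolution X) :
    ∃ (X' : Scheme.{0}) (π : X' ⟶ X), IsProper π ∧ IsBirational π ∧ ∀ x : X',
      (IsDomain (X'.presheaf.stalk x) ∧ ∀ d : ℕ, ringKrullDim (X'.presheaf.stalk x) = d → ∀ s : Fin d → (X'.presheaf.stalk x),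
        (Ideal.span (Set.range s)).radical.IsMaximal → ∀ y c : (X'.presheaf.stalk x), c ≠ 0 →
          (∀ e : ℕ, c * y ^ p ^ e ∈ Ideal.span ((fun z : (X'.presheaf.stalk x) => z ^ p ^ e) ''
            (Ideal.span (Set.range s) : Set (X'.presheaf.stalk x)))) → y ∈ Ideal.span (Set.range s)) := by
  obtain ⟨X', π, hπ⟩ := h
  refine ⟨X', π, hπ.isProper, hπ.isBirational, fun x => ?_⟩
  haveI := charP_stalk (π ≫ f) x
  exact rungThree_of_isRegularLocalRing hp _ (hπ.isRegular x)

/-- **A resolution of singularities is a rung-2 (locally integral CM F-injective) model**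
(`char k = p` prime). [folklore] -/
theorem rungTwoModel_of_hasResolution {p : ℕ} (hp : p.Prime) {k : Type} [Field k] [CharP k p]
    {X : Scheme.{0}} (f : X ⟶ Spec (.of k)) (h : Scheme.HasResolution X) :
    ∃ (X' : Scheme.{0}) (π : X' ⟶ X), IsProper π ∧ IsBirational π ∧ ∀ x : X',
      (IsDomain (X'.presheaf.stalk x) ∧ ∀ d : ℕ, ringKrullDim (X'.presheaf.stalk x) = d → ∀ s : Fin d → (X'.presheaf.stalk x),
        (Ideal.span (Set.range s)).radical.IsMaximal →
          RingTheory.Sequence.IsWeaklyRegular (X'.presheaf.stalk x) (List.ofFn s) ∧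
            ∀ y : (X'.presheaf.stalk x), (∃ e : ℕ, y ^ p ^ e ∈ Ideal.span ((fun z : (X'.presheaf.stalk x) => z ^ p ^ e) ''
              (Ideal.span (Set.range s) : Set (X'.presheaf.stalk x)))) → y ∈ Ideal.span (Set.range s)) := by
  obtain ⟨X', π, hπ⟩ := h
  refine ⟨X', π, hπ.isProper, hπ.isBirational, fun x => ?_⟩
  haveI := charP_stalk (π ≫ f) x
  exact rungTwo_of_isRegularLocalRing hp _ (hπ.isRegular x)

/-- **FAITHFULNESS / SUMMIT SHADOW: the ladder is equivalent to the summit.** The summit implies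
each of the three cruxes of route FrobeniusLadder (a resolution is a model of every rung), and the
route's deciding theorem `closes` is the converse. In particular no crux of the ladder is refutable
short of `¬ResolutionOfSingularities`. [folklore] -/
theorem frobeniusLadder_iff_summit :
    (FInjectiveMacaulayfication ∧ FRationalModification ∧ FRationalResolution) ↔
      _root_.ResolutionOfSingularities := by
  refine ⟨fun h => closes h.1 h.2.1 h.2.2, fun h => ⟨?_, ?_, ?_⟩⟩
  · intro p hp k _ _ X f hs hl hq hr
    exact rungTwoModel_of_hasResolution hp f (h p hp k X f hs hl hq hr)
  · intro p hp k _ _ X f hs hl hq hr _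
    exact rungThreeModel_of_hasResolution hp f (h p hp k X f hs hl hq hr)
  · intro p hp k _ _ X f hs hl hq hr _
    exact h p hp k X f hs hl hq hr

/-- **A refutation of the crux is a refutation of the summit.** [folklore] -/
theorem not_summit_of_not_fRationalModification (h : ¬ FRationalModification) :
    ¬ _root_.ResolutionOfSingularities :=
  fun hs => h (frobeniusLadder_iff_summit.mpr hs).2.1

/-- **The antecedent is logically unnecessary**: the summit gives every reduced separated finite-type
`X/k` (`char k = p` prime) a rung-3 model outright — the crux with its antecedent DROPPED is still a
consequence of the summit, so the antecedent cannot be shown load-bearing short of `¬summit`.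
[folklore] -/
theorem fRationalModification_without_antecedent_of_summit (h : _root_.ResolutionOfSingularities) :
    ∀ p : ℕ, p.Prime → ∀ (k : Type) [Field k] [CharP k p] (X : Scheme.{0}) (f : X ⟶ Spec (.of k)),
      IsSeparated f → LocallyOfFiniteType f → QuasiCompact f → IsReduced X →
        ∃ (X' : Scheme.{0}) (π : X' ⟶ X), IsProper π ∧ IsBirational π ∧ ∀ x : X',
          (IsDomain (X'.presheaf.stalk x) ∧ ∀ d : ℕ, ringKrullDim (X'.presheaf.stalk x) = d → ∀ s : Fin d → (X'.presheaf.stalk x),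
        (Ideal.span (Set.range s)).radical.IsMaximal → ∀ y c : (X'.presheaf.stalk x), c ≠ 0 →
          (∀ e : ℕ, c * y ^ p ^ e ∈ Ideal.span ((fun z : (X'.presheaf.stalk x) => z ^ p ^ e) ''
            (Ideal.span (Set.range s) : Set (X'.presheaf.stalk x)))) → y ∈ Ideal.span (Set.range s)) := by
  intro p hp k _ _ X f hs hl hq hr
  exact rungThreeModel_of_hasResolution hp f (h p hp k X f hs hl hq hr)

/-! ## §2 `p.Prime` is decoration -/

/-- **At exponent `0` no Noetherian local ring is rung-2**: with `e = 1`, `y ^ 0 ^ 1 = 1` and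
`span ((fun z => z ^ 0 ^ 1) '' I) = span {1} = ⊤`, so Frobenius closedness of a parameter ideal `I`
(which exists — Krull, `exists_isSystemOfParameters`) would force `I = ⊤`. [folklore] -/
theorem not_rungTwo_zero (R : Type) [CommRing R] [IsLocalRing R] [IsNoetherianRing R] :
    ¬ (IsDomain R ∧ ∀ d : ℕ, ringKrullDim R = d → ∀ s : Fin d → R,
        (Ideal.span (Set.range s)).radical.IsMaximal →
          RingTheory.Sequence.IsWeaklyRegular R (List.ofFn s) ∧
            ∀ y : R, (∃ e : ℕ, y ^ 0 ^ e ∈ Ideal.span ((fun z : R => z ^ 0 ^ e) ''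
              (Ideal.span (Set.range s) : Set R))) → y ∈ Ideal.span (Set.range s)) := by
  rintro ⟨_, h⟩
  obtain ⟨t, -, hcard⟩ := Ideal.exists_finset_card_eq_height_of_isNoetherianRing (maximalIdeal R)
  have hd : ringKrullDim R = (t.card : ℕ) := by
    rw [← maximalIdeal_height_eq_ringKrullDim, ← hcard]
    rfl
  obtain ⟨s, hs⟩ := exists_isSystemOfParameters hd
  obtain ⟨-, hmax⟩ := isSystemOfParameters_iff.mp hs
  set I : Ideal R := Ideal.span (Set.range s) with hI
  have himg : (fun z : R => z ^ 0 ^ 1) '' (I : Set R) = {1} := by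
    ext z
    simp only [pow_one, pow_zero, Set.mem_image, SetLike.mem_coe, Set.mem_singleton_iff]
    exact ⟨fun ⟨_, _, h⟩ => h.symm, fun h => ⟨0, I.zero_mem, h.symm⟩⟩
  have h1 : (1 : R) ∈ I := (h t.card hd s hmax).2 1 ⟨1, by
    rw [himg, Ideal.span_singleton_one]; exact Submodule.mem_top⟩
  exact hmax.ne_top ((Ideal.radical_eq_top).mpr ((Ideal.eq_top_iff_one I).mpr h1))

/-- **A birational morphism onto a nonempty scheme has nonempty source** (it is an isomorphism over a
dense, hence nonempty, open). [folklore] -/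
theorem nonempty_of_isBirational {X' X : Scheme.{0}} (π : X' ⟶ X) (h : IsBirational π)
    [Nonempty X] : Nonempty X' := by
  obtain ⟨U, hU, -, hiso⟩ := h
  obtain ⟨u, hu⟩ := hU.nonempty
  let y : ↥(π ⁻¹ᵁ U) := (Scheme.homeoOfIso (asIso (π ∣_ U))).symm ⟨u, hu⟩
  exact ⟨y.1⟩

/-- **The `p = 0` conjunct of the crux holds** (vacuously off `X = ∅`): over a field of characteristic
`0` a nonempty `X` has no rung-2 model at exponent `0` (`not_rungTwo_zero` at any stalk of the model,
which is a Noetherian local ring), and `X = ∅` is its own rung-3 model. [folklore] -/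
theorem fRationalModification_at_zero :
    ∀ (k : Type) [Field k] [CharP k 0] (X : Scheme.{0}) (f : X ⟶ Spec (.of k)),
      IsSeparated f → LocallyOfFiniteType f → QuasiCompact f → IsReduced X →
      (∃ (X' : Scheme.{0}) (π : X' ⟶ X), IsProper π ∧ IsBirational π ∧ ∀ x : X',
        (IsDomain (X'.presheaf.stalk x) ∧ ∀ d : ℕ, ringKrullDim (X'.presheaf.stalk x) = d → ∀ s : Fin d → (X'.presheaf.stalk x),
        (Ideal.span (Set.range s)).radical.IsMaximal →
          RingTheory.Sequence.IsWeaklyRegular (X'.presheaf.stalk x) (List.ofFn s) ∧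
            ∀ y : (X'.presheaf.stalk x), (∃ e : ℕ, y ^ 0 ^ e ∈ Ideal.span ((fun z : (X'.presheaf.stalk x) => z ^ 0 ^ e) ''
              (Ideal.span (Set.range s) : Set (X'.presheaf.stalk x)))) → y ∈ Ideal.span (Set.range s))) →
      ∃ (X' : Scheme.{0}) (π : X' ⟶ X), IsProper π ∧ IsBirational π ∧ ∀ x : X',
        (IsDomain (X'.presheaf.stalk x) ∧ ∀ d : ℕ, ringKrullDim (X'.presheaf.stalk x) = d → ∀ s : Fin d → (X'.presheaf.stalk x),
        (Ideal.span (Set.range s)).radical.IsMaximal → ∀ y c : (X'.presheaf.stalk x), c ≠ 0 →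
          (∀ e : ℕ, c * y ^ 0 ^ e ∈ Ideal.span ((fun z : (X'.presheaf.stalk x) => z ^ 0 ^ e) ''
            (Ideal.span (Set.range s) : Set (X'.presheaf.stalk x)))) → y ∈ Ideal.span (Set.range s)) := by
  intro k _ _ X f _ _ _ _ hH
  obtain ⟨X', π, hπ, hbir, hst⟩ := hH
  rcases isEmpty_or_nonempty X with hX | hX
  · exact ⟨X, 𝟙 X, inferInstance, ⟨⊤, by simp, by simp, inferInstance⟩, fun x => (hX.false x).elim⟩
  · exfalso
    obtain ⟨x'⟩ := nonempty_of_isBirational π hbir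
    haveI := hπ
    haveI : IsLocallyNoetherian X := LocallyOfFiniteType.isLocallyNoetherian f
    haveI : IsLocallyNoetherian X' := LocallyOfFiniteType.isLocallyNoetherian π
    exact not_rungTwo_zero (X'.presheaf.stalk x') (hst x')

/-- **`p.Prime` is decoration in the crux**: the crux with `p.Prime` dropped is equivalent to the crux
(a field has characteristic `0` or a prime, `CharP.char_is_prime_or_zero`, and the `p = 0` conjunct
holds, `fRationalModification_at_zero`). [folklore] -/
theorem fRationalModification_without_prime_iff :
    (∀ (p : ℕ) (k : Type) [Field k] [CharP k p] (X : Scheme.{0}) (f : X ⟶ Spec (.of k)),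
      IsSeparated f → LocallyOfFiniteType f → QuasiCompact f → IsReduced X →
      (∃ (X' : Scheme.{0}) (π : X' ⟶ X), IsProper π ∧ IsBirational π ∧ ∀ x : X',
        (IsDomain (X'.presheaf.stalk x) ∧ ∀ d : ℕ, ringKrullDim (X'.presheaf.stalk x) = d → ∀ s : Fin d → (X'.presheaf.stalk x),
        (Ideal.span (Set.range s)).radical.IsMaximal →
          RingTheory.Sequence.IsWeaklyRegular (X'.presheaf.stalk x) (List.ofFn s) ∧
            ∀ y : (X'.presheaf.stalk x), (∃ e : ℕ, y ^ p ^ e ∈ Ideal.span ((fun z : (X'.presheaf.stalk x) => z ^ p ^ e) ''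
              (Ideal.span (Set.range s) : Set (X'.presheaf.stalk x)))) → y ∈ Ideal.span (Set.range s))) →
      ∃ (X' : Scheme.{0}) (π : X' ⟶ X), IsProper π ∧ IsBirational π ∧ ∀ x : X',
        (IsDomain (X'.presheaf.stalk x) ∧ ∀ d : ℕ, ringKrullDim (X'.presheaf.stalk x) = d → ∀ s : Fin d → (X'.presheaf.stalk x),
        (Ideal.span (Set.range s)).radical.IsMaximal → ∀ y c : (X'.presheaf.stalk x), c ≠ 0 →
          (∀ e : ℕ, c * y ^ p ^ e ∈ Ideal.span ((fun z : (X'.presheaf.stalk x) => z ^ p ^ e) ''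
            (Ideal.span (Set.range s) : Set (X'.presheaf.stalk x)))) → y ∈ Ideal.span (Set.range s))) ↔
    FRationalModification := by
  refine ⟨fun h p _ => h p, fun h p k _ _ X f hs hl hq hr hH => ?_⟩
  rcases CharP.char_is_prime_or_zero k p with hp | rfl
  · exact h p hp k X f hs hl hq hr hH
  · exact fRationalModification_at_zero k X f hs hl hq hr hH

end Summit.ResolutionOfSingularities.ResolutionOfSingularities.Theorems.FRationalModification.Negative
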